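import Mathlib
import Summits.NavierStokesRegularity.NavierStokesRegularity.Theorems.FilamentSkeletonRssAreaLawSlavingDatumBlock
import Summits.NavierStokesRegularity.NavierStokesRegularity.Theorems.FilamentSkeletonRssAreaLawSlavingHoloScaledSlip
import Summits.NavierStokesRegularity.NavierStokesRegularity.Theorems.FilamentSkeletonRssAreaLawSlavingHoloStripRational

/-!
# Area-law slaving, complex part 15 — THE STRAIGHT DATUM'S SLIP IS STRIP-ANALYTIC; its scaled slaved area is stadium-analytic Γ-uniformly
# (`FilamentSkeletonRss`, child crux `TangentSkeletonNearStraight`, stmt-NavierStokesRegularity-28295, line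
# `child_tangent_analytic_strip`, ∃-side of the registered stub `stub_analyticClosing`: the `StadiumAnalyticArea` conjunct AT THE DATUM)

The zeroth iterate of the line's scheme has slip `w⁰(τ) = √Γ·W_j(τ/√Γ)`, `W_j` the straight datum's closed-form slip (`StraightDatum`).
Real part 10 (`datum_slip_eq`) wrote `W_j(s) = s/2 + K_j + Σ_{k≠j} (γ_k/2π)·n_jk/‖d⁰_jk + s e_jk‖²` with `‖d⁰_jk + s e_jk‖ ≥ ρ`
(separation) and `‖e_jk‖ ≤ 1`.  Complex part 14 complexified such rational profiles on the strip `{|Im s| < ρ}` with explicit bounds,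
and complex part 13 turned a strip-analytic profile into the `StadiumAnalyticArea` conjunct for the scaled slip, Γ-uniformly.  This file
puts the three together:

* `straightDatum_slip_strip_analytic` — for a `ρ`-separated unit-direction straight datum and filament `j`: an explicit `Wc : ℂ → ℂ`,
  holomorphic on `{|Im s| < ρ}`, with real trace `W_j`, and on `{|Im s| < ρ/4}`: `‖Wc′‖ ≤ M₀ = 1/2 + 8B/ρ`, `‖Wc″‖ ≤ 64B/ρ²`,
  `B = Σ_{k≠j} |γ_k/2π|·4|n_jk|/(3ρ²)` (Γ-free, datum-dependent);
* `straightDatum_stadium_analytic_area` — HEADLINE: if moreover `W_j(s₀) = 0`, `W_j′(s₀) > 3/2`, `mw|s − s₀| ≤ |W_j(s)|` (the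
  `StraightDatum` zero clauses), then for every `Γ ≥ 1` and `cs ≤ ρ/4` with the Γ-FREE smallness `cs·K₀ ≤ 1/8`,
  `8K₀cs(18 + 12M₀ + 48Λ) ≤ mw` (`K₀ = 64B/ρ² + 1`) and the fit `√Γ/(8K₀) < L + cs√Γ`, the slaved area `Aa` of the scaled slip
  `w⁰ = √Γ·W_j(·/√Γ)` (area law on `ℝ`, floor `Λ⁻¹ ≤ Aa` — real part 10 `straightDatum_slavedArea_block` provides it) satisfies
  `StadiumAnalyticArea (cs√Γ) L (√Γ s₀) Aa` (unfolded).  With real part 10 this completes: THE ZEROTH ITERATE CARRIES THE WHOLE AREA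
  BLOCK OF `TangentSkeletonAnalytic`, INCLUDING ITS ANALYTIC CONJUNCT, Γ-UNIFORMLY.

HONEST FRAMING: vector algebra + textbook complex analysis about the straight datum of a HYPOTHETICAL filament skeleton on the NEGATIVE side
of a MODEL route; no registered stub is closed by this file and nothing here bears on Navier–Stokes regularity or blow-up.
`--supports stmt-NavierStokesRegularity-28295`.
-/

set_option linter.dupNamespace false

noncomputable section

namespace Summit.NavierStokesRegularity.NavierStokesRegularity.Theorems.AreaLawSlavingHolo

open Set Metric Filter Real Finset
open scoped Topology BigOperators InnerProductSpace
open Literature.Analysis.FluidPDE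
open Summit.NavierStokesRegularity.NavierStokesRegularity.Theorems.AreaLawSlaving

/-- **The straight datum's slip is strip-analytic with explicit bounds.**  See the module docstring. [folklore] -/
theorem straightDatum_slip_strip_analytic {N : ℕ} {ρ α : ℝ} {p t : Fin N → EuclideanSpace ℝ (Fin 3)} {γ : Fin N → ℝ}
    (hρ : 0 < ρ) (ht : ∀ j, ‖t j‖ = 1)
    (hsep : ∀ j k, j ≠ k → ∀ τ σ : ℝ, ρ ≤ ‖(p j + τ • t j) - (p k + σ • t k)‖)
    (W : Fin N → ℝ → ℝ)
    (hW : ∀ j s, W j s = ⟪(∑ k ∈ Finset.univ.erase j, (γ k / (2 * Real.pi)) •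
      ((‖(p j + s • t j - p k) - ⟪p j + s • t j - p k, t k⟫_ℝ • t k‖ ^ 2)⁻¹ •
        cross (t k) ((p j + s • t j - p k) - ⟪p j + s • t j - p k, t k⟫_ℝ • t k))) +
      (1 / 2 : ℝ) • (p j + s • t j) - α • cross (EuclideanSpace.single 2 1) (p j + s • t j), t j⟫_ℝ)
    (j : Fin N) :
    ∃ Wc : ℂ → ℂ, DifferentiableOn ℂ Wc {s : ℂ | |s.im| < ρ} ∧ (∀ x : ℝ, Wc x = ((W j x : ℝ) : ℂ)) ∧
      ∀ z ∈ {s : ℂ | |s.im| < ρ / 4},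
        ‖deriv Wc z‖ ≤ 1 / 2 + 8 * (∑ k ∈ Finset.univ.erase j, |γ k / (2 * Real.pi)| *
          (4 * |⟪cross (t k) ((p j - p k) - ⟪p j - p k, t k⟫_ℝ • t k), t j⟫_ℝ| / (3 * ρ ^ 2))) / ρ ∧
        ‖deriv (deriv Wc) z‖ ≤ 64 * (∑ k ∈ Finset.univ.erase j, |γ k / (2 * Real.pi)| *
          (4 * |⟪cross (t k) ((p j - p k) - ⟪p j - p k, t k⟫_ℝ • t k), t j⟫_ℝ| / (3 * ρ ^ 2))) / ρ ^ 2 := by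
  -- the datum's scalars
  set d₀ : Fin N → EuclideanSpace ℝ (Fin 3) := fun k => (p j - p k) - ⟪p j - p k, t k⟫_ℝ • t k with hd₀
  set e : Fin N → EuclideanSpace ℝ (Fin 3) := fun k => t j - ⟪t j, t k⟫_ℝ • t k with he
  set n : Fin N → ℝ := fun k => ⟪cross (t k) (d₀ k), t j⟫_ℝ with hn
  set a : Fin N → ℝ := fun k => ‖d₀ k‖ ^ 2 with ha
  set b : Fin N → ℝ := fun k => ⟪d₀ k, e k⟫_ℝ with hb
  set c : Fin N → ℝ := fun k => ‖e k‖ ^ 2 with hc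
  set K : ℝ := (1 / 2) * ⟪p j + (0:ℝ) • t j, t j⟫_ℝ - α * ⟪cross (EuclideanSpace.single 2 1) (p j + (0:ℝ) • t j), t j⟫_ℝ
    with hK
  -- (F1) `q_k(x) = ‖d⁰ + x e‖² ≥ ρ²` on `ℝ`
  have hq_eq : ∀ k (x : ℝ), a k + 2 * b k * x + c k * x ^ 2 = ‖d₀ k + x • e k‖ ^ 2 := by
    intro k x
    have h : ‖d₀ k + x • e k‖ ^ 2 = ‖d₀ k‖ ^ 2 + 2 * ⟪d₀ k, e k⟫_ℝ * x + ‖e k‖ ^ 2 * x ^ 2 := by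
      have := congrFun (normSq_affine_eq (d₀ k) (e k)) x
      simpa using this
    rw [h]
  have hq : ∀ k ∈ Finset.univ.erase j, ∀ x : ℝ, ρ ^ 2 ≤ a k + 2 * b k * x + c k * x ^ 2 := by
    intro k hk x
    have hkj : j ≠ k := fun h => (Finset.ne_of_mem_erase hk) h.symm
    have h := hsep j k hkj x (⟪p j + x • t j - p k, t k⟫_ℝ)
    have e1 : (p j + x • t j) - (p k + ⟪p j + x • t j - p k, t k⟫_ℝ • t k) =
        (p j + x • t j - p k) - ⟪p j + x • t j - p k, t k⟫_ℝ • t k := by abel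
    rw [e1, foot_affine] at h
    rw [hq_eq]
    exact pow_le_pow_left₀ hρ.le h 2
  -- (F2) `c_k ≤ 1`
  have hc1 : ∀ k ∈ Finset.univ.erase j, c k ≤ 1 := by
    intro k _
    have h := norm_dir_le_one (ht j) (ht k)
    show ‖e k‖ ^ 2 ≤ 1
    nlinarith [norm_nonneg (e k)]
  -- (F3) the real profile
  have hWj : ∀ x : ℝ, W j x = x / 2 + K + ∑ k ∈ Finset.univ.erase j, γ k / (2 * Real.pi) *
      (n k / (a k + 2 * b k * x + c k * x ^ 2)) := by
    intro x
    have h := congrFun (datum_slip_eq ht W hW j) x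
    rw [h]
    simp only [hq_eq]
    ring
  -- the complex profile
  refine ⟨fun s : ℂ => s / 2 + (K : ℂ) + ∑ k ∈ Finset.univ.erase j, (γ k / (2 * Real.pi) : ℂ) *
      ((n k : ℂ) / ((a k : ℂ) + 2 * (b k : ℂ) * s + (c k : ℂ) * s ^ 2)),
    rationalProfile_holo _ γ n a b c K ρ hq hc1, fun x => ?_, fun z hz => ?_⟩
  · beta_reduce
    rw [rationalProfile_ofReal, hWj x]
  · exact rationalProfile_deriv_bounds _ γ n a b c K hρ hq hc1 z hz

/-- **HEADLINE: the straight datum's scaled slaved area is stadium-analytic, Γ-uniformly.**  See the module docstring. [folklore] -/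
theorem straightDatum_stadium_analytic_area {N : ℕ} {ρ α mw s₀ cs Γ L Λ : ℝ} {p t : Fin N → EuclideanSpace ℝ (Fin 3)}
    {γ : Fin N → ℝ} (hρ : 0 < ρ) (ht : ∀ j, ‖t j‖ = 1)
    (hsep : ∀ j k, j ≠ k → ∀ τ σ : ℝ, ρ ≤ ‖(p j + τ • t j) - (p k + σ • t k)‖)
    (W : Fin N → ℝ → ℝ)
    (hW : ∀ j s, W j s = ⟪(∑ k ∈ Finset.univ.erase j, (γ k / (2 * Real.pi)) •
      ((‖(p j + s • t j - p k) - ⟪p j + s • t j - p k, t k⟫_ℝ • t k‖ ^ 2)⁻¹ •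
        cross (t k) ((p j + s • t j - p k) - ⟪p j + s • t j - p k, t k⟫_ℝ • t k))) +
      (1 / 2 : ℝ) • (p j + s • t j) - α • cross (EuclideanSpace.single 2 1) (p j + s • t j), t j⟫_ℝ)
    (j : Fin N) (hW0 : W j s₀ = 0) (hsup : 3 / 2 < deriv (W j) s₀) (hmw : 0 < mw)
    (hfloor : ∀ s : ℝ, mw * |s - s₀| ≤ |W j s|)
    (hΓ : 1 ≤ Γ) (hcs : 0 < cs) (hcsρ : cs ≤ ρ / 4) (hΛ : 0 < Λ)
    {B K₀ M₀ : ℝ}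
    (hB : B = ∑ k ∈ Finset.univ.erase j, |γ k / (2 * Real.pi)| *
      (4 * |⟪cross (t k) ((p j - p k) - ⟪p j - p k, t k⟫_ℝ • t k), t j⟫_ℝ| / (3 * ρ ^ 2)))
    (hK₀ : K₀ = 64 * B / ρ ^ 2 + 1) (hM₀ : M₀ = 1 / 2 + 8 * B / ρ)
    (hsmall₁ : cs * K₀ ≤ 1 / 8) (hsmall₂ : 8 * K₀ * cs * (18 + 12 * M₀ + 48 * Λ) ≤ mw)
    (hfit : √Γ / (8 * K₀) < L + cs * √Γ)
    {w0 : ℝ → ℝ} (hw0 : ∀ τ : ℝ, w0 τ = √Γ * W j (τ / √Γ))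
    {Aa : ℝ → ℝ} (hAd : Differentiable ℝ Aa) (hlaw : ∀ τ, w0 τ * deriv Aa τ = (3 / 2 - deriv w0 τ) * Aa τ + 4)
    (hAfloor : ∀ τ, Λ⁻¹ ≤ Aa τ) :
    ∃ G : ℂ → ℂ, DifferentiableOn ℂ G {z : ℂ | |z.im| < cs * √Γ ∧ |z.re - √Γ * s₀| < L + cs * √Γ} ∧
      (∀ t : ℝ, (t : ℂ) ∈ {z : ℂ | |z.im| < cs * √Γ ∧ |z.re - √Γ * s₀| < L + cs * √Γ} → G t = ((Aa t : ℝ) : ℂ)) ∧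
      ∀ z ∈ {z : ℂ | |z.im| < cs * √Γ ∧ |z.re - √Γ * s₀| < L + cs * √Γ},
        Aa z.re / 2 ≤ (G z).re ∧ ‖G z‖ ≤ 2 * Aa z.re := by
  obtain ⟨Wc, hWcD, hWtr, hWbd⟩ := straightDatum_slip_strip_analytic hρ ht hsep W hW j
  have hB0 : 0 ≤ B := by
    rw [hB]; exact Finset.sum_nonneg fun k _ => by positivity
  have hK₀pos : 0 < K₀ := by rw [hK₀]; positivity
  -- the profile on the quarter strip
  have hσ : DifferentiableOn ℂ Wc {s : ℂ | |s.im| < ρ / 4} :=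
    hWcD.mono fun s (hs : |s.im| < ρ / 4) => show |s.im| < ρ by linarith [abs_nonneg s.im]
  have hW_re : ∀ x : ℝ, (Wc x).im = 0 := fun x => by rw [hWtr x]; simp
  have hWc0 : Wc s₀ = 0 := by rw [hWtr s₀, hW0]; simp
  have hWc_sup : 3 / 2 < (deriv Wc s₀).re := by
    have hs₀ : (s₀ : ℂ) ∈ {s : ℂ | |s.im| < ρ} := by simpa using hρ
    have h1 : HasDerivAt (fun x : ℝ => (Wc x).re) (deriv Wc s₀).re s₀ :=
      ((hWcD.differentiableAt ((strip_isOpen ρ).mem_nhds hs₀)).hasDerivAt).real_of_complex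
    have hfun : (fun x : ℝ => (Wc x).re) = W j := by
      funext x; rw [hWtr x]; simp
    rw [hfun] at h1
    rw [← h1.deriv]; exact hsup
  have hK₀bd : ∀ s ∈ {s : ℂ | |s.im| < ρ / 4}, ‖deriv (deriv Wc) s‖ ≤ K₀ := by
    intro s hs; rw [hK₀, hB]; linarith [(hWbd s hs).2]
  have hM₀bd : ∀ s ∈ {s : ℂ | |s.im| < ρ / 4}, ‖deriv Wc s‖ ≤ M₀ := by
    intro s hs; rw [hM₀, hB]; exact (hWbd s hs).1
  have hfloorC : ∀ x : ℝ, mw * |x - s₀| ≤ ‖Wc x‖ := by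
    intro x; rw [hWtr x, Complex.norm_real, Real.norm_eq_abs]; exact hfloor x
  -- the scaled real slip is `√Γ · Re Wc(τ/√Γ)`
  have hwj : ∀ τ : ℝ, w0 τ = √Γ * (Wc ((τ / √Γ : ℝ) : ℂ)).re := by
    intro τ; rw [hw0 τ, hWtr]; simp
  exact stadium_analytic_area_of_scaled_slip hΓ hcs hcsρ hK₀pos hmw hΛ hσ hW_re hWc0 hWc_sup hK₀bd hM₀bd hfloorC
    hsmall₁ hsmall₂ hfit hwj hAd hlaw hAfloor

end Summit.NavierStokesRegularity.NavierStokesRegularity.Theorems.AreaLawSlavingHolo
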